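/-
Copyright (c) 2026 the pub-hodgecm-mathlib formalisation cell (harness21).  Prover seat hodgecm-mathlib-LH4-p13 (g10), req620 Track A «(D-RAM) FOUR-FRAME» squad
F0∕P3c∕LH4; the (β₂) road (R-36), β₂ WORD #22 (2) ∕ #29 of the sub-dealer LH4-p04: «THE LABEL LAW» in ‹OFF.v2›'s GENERAL-BLOCK spelling `(H₂, hW, P₁)` — FILE 3;
helper lane on h413 = stmt-HodgeConjecture-24833 (count-neutral).  2026-09-05.
-/
import Summits.HodgeConjecture.HodgeConjecture.Theorems.F0P3cDyRamCleanShellLabelLaw      -- ★ p864014 (this seat): §4 HEAD `exists_fixed_unit_latticeValueSet_eq_smul_xPlus_of_shell`, §5 `v_trace_det_of_near_one`, `fence_endoGL_sub_one`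
import HarnessLib

/-!
# Crux `H413`, line LH4 «(D-RAM) FOUR-FRAME» — the (β₂) road (R-36): «THE LABEL LAW» IN ‹OFF.v2›'s GENERAL-BLOCK SPELLING (FILE 3 of the label law)

Cell `hodgecm-mathlib` (D-0151), FLOOR 0, crux item H413 = `stmt-HodgeConjecture-24833`, route of record `HCCMUnconditional`; squad F0∕P3c∕LH4; lane
`--supports stmt-HodgeConjecture-24833 --as helper` (count-neutral; pays NO tier-0 row).  THEOREMS ONLY (no `def`, no instance, no notation, no `sorry`, default heartbeats);
★-only imports; states NO census law; (β₂) and the (OFF) residue stay HYPOTHESES of their holders.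

WHAT.  ★ p864014 §5 typed the law for the two EXPLICIT literals (`Φ₃ = block(Φ₂, 1)` with `_hΓ : endoGL (γ₂, u) ∈ U(Φ₃)`; `block(diag dg, η)` with `γ₁`).  The (OFF)∕(ROW)
assemblies of the β₂ board (★ p861305 §3, ★ `offRowU_of_bands` ∕ `offRowD_of_bands` ∕ `offRowL_of_bands`, LH4-p12) are written ONCE in the GENERAL-BLOCK spelling of ‹OFF.v2›
3abc7da0: an arbitrary hermitian plane block `H₂` (`_hH₂σ : (σH₂)ᵀ = H₂`), a `σ`-fixed line scalar `hW` (`_hhWσ`), the form `!![H₂ 0 0, 0, H₂ 0 1; 0, hW, 0; H₂ 1 0, 0, H₂ 1 1]`,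
and `Γ = endoGL (γ₂, u)` unitary for it through a frame `P₁` (`_hA : formCongr σ P₁ Φ₃ = block`, `_hΓ : P₁·Γ·P₁⁻¹ ∈ U(Φ₃)`), with the fence `_hg1`, `_hu1N` on `γ₂`, `u`
themselves.  THIS FILE is that spelling: **`exists_fixed_unit_valueSet_eq_smul_xPlus_of_shell_block`** — binders a subset BY NAME AND BYTE of the general block (`σ ϖ d tE _hD _h2 γ₂ u
_hu1N _hg1 H₂ hW _hH₂σ _hhWσ P₁ _hA _hΓ`, fence exponent `n := N d tE (Nat.card 𝓀[E])` with the holder's floor `mcOfRecord d ≤ n`), then per vertex the three set-builder conjuncts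
`IsSelfDualLattice σ ϖ block L₃`, `mapGL (endoGL (γ₂, u)) L₃ = L₃`, `LatticeNearTransvShell ϖ (d % 2) (mcOfRecord d) (Γ − 1) L₃` ⊢ `∃ e′, σ e′ = e′ ∧ |e′| = 1 ∧ VS_{m*}(L₃) =
valueSetMod σ ϖ (mstarOfRecord d) (e′ • xPlus σ ϖ d)` with the set-LHS in the letter's bytes — the `hdich` witness of ★ p861368 `latticeLabelPlus_iff_not_of_near_one`-type exchange
faces at every clean-shell vertex, every cell, both literals.  Proof: ★ p864014 §4 HEAD at `H := block` (hermitian from `_hH₂σ`, `_hhWσ`), unitarity by ★ `conj_mem_unitaryGroupOfForm_iff`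
and `_hA`, fence by ★ p864014 §5 `v_trace_det_of_near_one` + `fence_endoGL_sub_one`, `2 ≤ d` from `_h2` (★ `two_le_of_v_two_lt_one`).

HONEST LABEL.  Count-neutral corollary; nothing printed is asserted; no census law is stated; (β₂), the (OFF) residue (`hU_mix`, `hD_mix`, ‹hL_mix_hi›) and ‹CORE-3› stay OPEN
with their holders; `HC_CM` is proved only modulo the 7 printed citations (2 remaining named inputs: hLiu418 = `stmt-HodgeConjecture-24832`, h413 = `stmt-HodgeConjecture-24833`)
until rung 0 closes.

## References
* [Rogawski1990] J. D. Rogawski, *Automorphic Representations of Unitary Groups in Three Variables*, Ann. of Math. Stud. 123 (1990): §4.8 Case (a) p. 53, §4.9 Prop. 4.9.1 (b) p. 55.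
* [Kottwitz1986BaseChangeUnits] R. E. Kottwitz, *Base change for unit elements of Hecke algebras*, Compositio Math. 60 (1986): §1 pp. 240–241, §3.
* [Jacobowitz1962] R. Jacobowitz, *Hermitian forms over local fields*, Amer. J. Math. 84 (1962): §4, §7.
-/

set_option autoImplicit false

noncomputable section

namespace Summit.HodgeConjecture.HodgeConjecture.Cruxes.H413.F0P3cDyRamCleanShellLabelLawBlock

open scoped Valued WithZero Matrix MatrixGroups
open WithZero
open Literature.NumberTheory.Automorphic Literature.NumberTheory.Automorphic.HermitianLattice Literature.NumberTheory.Automorphic.UnitaryLatticeTree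
open Literature.NumberTheory.Automorphic.UnitaryThreeFourFrame (IsRamifiedQuadraticDatum)
open Literature.NumberTheory.Rogawski1990
open Literature.NumberTheory.LocalFields.WildQuadraticDatum (two_le_of_v_two_lt_one)
open Summit.HodgeConjecture.HodgeConjecture.Cruxes.H413.F0P3cDyRamFourFramePieces (valueSetMod xPlus mstarOfRecord)
open Summit.HodgeConjecture.HodgeConjecture.Cruxes.H413.F0P3cDyRamFourFrameCensusDefs (LatticeInLevel LatticeNearTransvShell)
open Summit.HodgeConjecture.HodgeConjecture.Cruxes.H413.F0P3cDyRamStageOneBDefs (mcOfRecord)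
open Summit.HodgeConjecture.HodgeConjecture.Cruxes.H413.F0P3cDyRamCleanShellLabelLaw

variable {E : Type} [Field E] [Valued E ℤᵐ⁰]

/-- **«ON THE CLEAN SHELL EVERY VERTEX IS LABELLED `±`» IN ‹OFF.v2›'s GENERAL-BLOCK SPELLING.**  Block form `!![H₂ 0 0, 0, H₂ 0 1; 0, hW, 0; H₂ 1 0, 0, H₂ 1 1]` (`(σH₂)ᵀ = H₂`,
`σ hW = hW`), `Γ = endoGL (γ₂, u)` unitary for it through `P₁` (`_hA`, `_hΓ`), fence `_hg1`, `_hu1N` at an exponent `n ≥ mcOfRecord d`, `2 ≤ d` from `_h2`; per vertex: self-dual,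
`Γ`-fixed, on the clean shell `(d % 2, mcOfRecord d)` ⟹ `VS_{m*}(L₃) = valueSetMod σ ϖ (mstarOfRecord d) (e′ • xPlus σ ϖ d)` for a `σ`-fixed unit `e′` (★ p864014 §4 HEAD).
[cite: Rogawski1990, §4.9 Prop. 4.9.1 (b) p. 55] [cite: Kottwitz1986BaseChangeUnits, §1 pp. 240–241] [cite: Jacobowitz1962, §4, §7] -/
theorem exists_fixed_unit_valueSet_eq_smul_xPlus_of_shell_block
    (σ : E →+* E) (ϖ : E) (d tE : ℕ) (_hD : IsRamifiedQuadraticDatum σ ϖ d tE) (_h2 : ¬ IsUnit (2 : 𝒪[E]))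
    (γ₂ : GL (Fin 2) E) (u : GL (Fin 1) E) {n : ℕ} (hn : mcOfRecord d ≤ n)
    (_hu1N : Valued.v (((u : Matrix (Fin 1) (Fin 1) E) 0 0) - 1) ≤ Valued.v (ϖ ^ n))
    (_hg1 : ∀ i j, Valued.v ((γ₂ : Matrix (Fin 2) (Fin 2) E) i j - (1 : Matrix (Fin 2) (Fin 2) E) i j) ≤ Valued.v (ϖ ^ n))
    (H₂ : Matrix (Fin 2) (Fin 2) E) (hW : E) (_hH₂σ : (H₂.map σ)ᵀ = H₂) (_hhWσ : σ hW = hW)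
    (P₁ : GL (Fin 3) E) (_hA : formCongr σ P₁ ((StdForm.antidiagonal 3).over E) = (!![H₂ 0 0, 0, H₂ 0 1; 0, hW, 0; H₂ 1 0, 0, H₂ 1 1] : Matrix (Fin 3) (Fin 3) E))
    (_hΓ : P₁ * endoGL (γ₂, u) * P₁⁻¹ ∈ unitaryGroupOfForm σ ((StdForm.antidiagonal 3).over E))
    {L₃ : Submodule 𝒪[E] (Fin 3 → E)}
    (hL₃ : IsSelfDualLattice σ ϖ (!![H₂ 0 0, 0, H₂ 0 1; 0, hW, 0; H₂ 1 0, 0, H₂ 1 1] : Matrix (Fin 3) (Fin 3) E) L₃)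
    (hΓL₃ : mapGL (endoGL (γ₂, u)) L₃ = L₃)
    (hshell : LatticeNearTransvShell ϖ (d % 2) (mcOfRecord d) ((((endoGL (γ₂, u) : GL (Fin 3) E) : Matrix (Fin 3) (Fin 3) E) - 1)) L₃) :
    ∃ e' : E, σ e' = e' ∧ Valued.v e' = 1 ∧
      {z : E | ∃ y ∈ L₃, Valued.v ((ϖ ^ (mstarOfRecord d))⁻¹ * (z - pairing σ (!![H₂ 0 0, 0, H₂ 0 1; 0, hW, 0; H₂ 1 0, 0, H₂ 1 1] : Matrix (Fin 3) (Fin 3) E) y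
          (((((endoGL (γ₂, u) : GL (Fin 3) E) : Matrix (Fin 3) (Fin 3) E) - 1)) *ᵥ y))) ≤ 1} =
        valueSetMod σ ϖ (mstarOfRecord d) (e' • xPlus σ ϖ d) := by
  obtain ⟨hσσ, hvσ, hϖ, hfix, hdd, -, ht⟩ := id _hD
  have hϖ1 : Valued.v ϖ ≤ 1 := by rw [hϖ, ← exp_zero, exp_le_exp]; norm_num
  have h2v : Valued.v (2 : E) < 1 := by exact_mod_cast Valuation.Integer.not_isUnit_iff_valuation_lt_one.mp _h2
  have hd2 : 2 ≤ d := two_le_of_v_two_lt_one hσσ hvσ hfix hϖ hdd ht h2v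
  have hHe : ∀ i j, σ (H₂ j i) = H₂ i j := fun i j => by
    have e := congrFun (congrFun _hH₂σ i) j
    rwa [Matrix.transpose_apply, Matrix.map_apply] at e
  have hH : ((!![H₂ 0 0, 0, H₂ 0 1; 0, hW, 0; H₂ 1 0, 0, H₂ 1 1] : Matrix (Fin 3) (Fin 3) E).map σ)ᵀ = (!![H₂ 0 0, 0, H₂ 0 1; 0, hW, 0; H₂ 1 0, 0, H₂ 1 1] : Matrix (Fin 3) (Fin 3) E) := by
    ext i j; fin_cases i <;> fin_cases j <;> simp [hHe, _hhWσ]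
  have hΓ : endoGL (γ₂, u) ∈ unitaryGroupOfForm σ (!![H₂ 0 0, 0, H₂ 0 1; 0, hW, 0; H₂ 1 0, 0, H₂ 1 1] : Matrix (Fin 3) (Fin 3) E) := by
    rw [← _hA]; exact (conj_mem_unitaryGroupOfForm_iff σ P₁ _ _).1 _hΓ
  obtain ⟨htr2, hdet2⟩ := v_trace_det_of_near_one hϖ1 _hg1
  have hu1 : Valued.v (((u : Matrix (Fin 1) (Fin 1) E) 0 0) - 1) ≤ Valued.v ϖ ^ n := by rw [map_pow] at _hu1N; exact _hu1N
  obtain ⟨htrX, he₂X⟩ := fence_endoGL_sub_one hϖ1 γ₂ u htr2 hdet2 hu1 rfl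
  exact exists_fixed_unit_latticeValueSet_eq_smul_xPlus_of_shell _hD hd2 _ hH hL₃ hΓ hΓL₃ rfl hshell hn htrX he₂X

end Summit.HodgeConjecture.HodgeConjecture.Cruxes.H413.F0P3cDyRamCleanShellLabelLawBlock

end
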